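import Summits.QuantumFields.YangMills.Theorems.FluctuationComparisonRegPrIntLS2BetaSqrtGaugeFillingTwoFaceSection
import Summits.QuantumFields.YangMills.Theorems.FluctuationComparisonRegPrIntLS2BetaFlooredSupplierOfFillings
import HarnessLib

/-!
# S2β · D-GUARD ∕ (BG∞) — FILL₁ DISCHARGED, AND `hBG` BY KERNEL ((F1b), part 2∕2 of FILL₁): the stage-1 filling letter `h₁` of ✓`…SectionsOfFillings.hSec_of_fillings`
# (two opposite faces, single scale `E = 1∕40`) holds with `A := 16`, `ρ₀ := 2` — ✓`twoFace_section` at `r := 1∕3`, `m := ρ`, `ℓ₁ := n α ∕ 2`, `ℓ₂ := n α − n α ∕ 2`;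
# hence ✓`…FlooredSupplierOfFillings.hBG_of_fillings fill1` is the conjectured N-uniform small-bond gauge `hBG` of the (BG∞) road, and `hsupp_floor_of_fillings … fill1`
# the floored supplier letter, BY KERNEL (LEAD-20520 w3 g29 №67 delegation (1))

Cell `ym3-torus` (YM ladder rung R3 = continuum `SU(2)` Yang–Mills on the three-torus at fixed lattice data — a RUNG: NOT d = 4, NOT infinite volume,
NOT a mass gap, NOT Clay).  Width seat «width 20» `ym3-torus-px20` (gen 25), FREE px helper on crux `stmt-QuantumFields-20520` (`FluctuationComparisonRegPrIntL`;
registry `Lines/semiclassical_s2beta.lean` v11 3732b7df UNTOUCHED, 0∕5), free hand on FILL₁ per LEAD №64∕№67 and `Cruxes/…/FILL1-SPEC-w3g29.md`;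
`--kind proof --supports stmt-QuantumFields-20520 --as helper`, count-neutral, DEFINITION-FREE (0 `def`, 0 `instance`, 0 `notation`, 0 `sorry`, default heartbeats).

WHAT IS PROVED (sorry-free).
* §1 numerics at `E = 1∕40` with `r := 1∕3`, `m := ρ`, `A := 16`, `ρ₀ := 2`: `rad_le_third` (`(π∕2)·2(ρ−1)·ε ≤ 1∕6`), `card_lt_one_third` (the two-face packing count:
  `n κ < 2ρ` so `2·2·2·(2∕(3π))·(1∕2)³ = 2∕(3π) < 1`), `transverse_le_third` (`((π − 1∕3)∕sin(1∕3))·ε ≤ 16∕ρ`, by ✓`Lambda_le` IMPORTED from px5's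
  ✓`…SqrtGaugeFillingTube`, `π ≤ 4`), `axial_le` (`max (π∕⌊n α∕2⌋) (π∕⌈n α∕2⌉) ≤ 16∕ρ`).
* §2 ★★★ `fill1 : ⟨h₁ of ✓hSec_of_fillings, VERBATIM⟩` — `by_cases` on the slowness premise (else `W := ψ`), then ✓`twoFace_section`.
* §3 ★★★ `hBG_holds : ∃ C c, 0 ≤ C ∧ ∀ F J θ, 0 < θ → ∀ V, PlaqSmall θ V → ∃ u, ∀ e, ‖logVec (su2Quat ((u·V) e))‖ ≤ C·√θ + c∕N_J := hBG_of_fillings fill1` — the (BG∞)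
  letter of UV3-NODE §114∕§116 (an elementary, NOT-in-print, torus-global small-bond gauge for `SU(2)` lattice fields with `θ`-small plaquettes, `N`-uniform) CLOSED BY
  KERNEL; ★★ `hsupp_floor_holds (G) (hGinv) (hs₀) := hsupp_floor_of_fillings G hGinv hs₀ fill1` — the floored supplier letter of GAP♯∘_v12 for every gauge-invariant class.

HONEST SCOPE.  Lattice `SU(2)` geometry (two-leg fillings through a packing centre) and elementary numerics; nothing of Bałaban's renormalisation-group analysis is
asserted or proved ([Balaban1985RegularSpaces] Lemma 1 p.79, (1.29) p.81, Thm 2 p.83 are the printed local small gauges this globalises on the torus).  `hBG` is the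
SUPPLIER side only: GAP♯∘ (`stub_uniformFibreGapOrbit`, registry v11 3732b7df UNTOUCHED), the five registered stubs (0∕5), the (E)-side letters (h3, hD ×2, hDBX⁗ ×2),
S2β, crux 20520, 19936, 19200 and `YM3TorusSU2` are NOT proved; no registered stub is closed; rung R3 — NOT d = 4, NOT infinite volume, NOT a mass gap, NOT Clay;
the Yang–Mills mass gap is NOT proved.  Axioms standard.

References: T. Bałaban, CMP **99** (1985) 75–102 [Balaban1985RegularSpaces] (Lemma 1 p.79, (1.29) p.81, Thm 2 p.83); CMP **102** (1985) 255–275 [Balaban1985UV3] ((3) p.256).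
-/

set_option autoImplicit false

noncomputable section

namespace Summit.QuantumFields.YangMills.Theorems.FluctuationComparisonRegPrIntLS2BetaSqrtGaugeFill1

open scoped Real
open Literature.MathematicalPhysics.QuantumLattice (su2Quat)
open Literature.MathematicalPhysics.QuantumFieldTheory.Balaban1983to89
open T4CubeChartGnomonic (SU2)
open T4ExpWindowSmallField (logVec)
open T3ContinuumYM3Torus (T3Family)
open T3UnitScaleTilt (θBal)
open Summit.QuantumFields.YangMills.Theorems.FluctuationComparisonRegPrIntLS2BetaSqrtGaugeFillingTwoFaceSection (twoFace_section)
open Summit.QuantumFields.YangMills.Theorems.FluctuationComparisonRegPrIntLS2BetaSqrtGaugeFillingTube (Lambda_le side_lt)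
open Summit.QuantumFields.YangMills.Theorems.FluctuationComparisonRegPrIntLS2BetaFlooredSupplierOfFillings (hBG_of_fillings hsupp_floor_of_fillings)

/-! ## §1 Numerics at `E = 1∕40`: `r := 1∕3`, `m := ρ`, `A := 16`, `ρ₀ := 2` -/

/-- **The patch radius at `m := ρ`**: `0 ≤ ε`, `ε·ρ ≤ 1∕40` give `(π∕2)·(2(ρ−1))·ε ≤ (1∕3)∕2` (`π ≤ 4`). [folklore] -/
theorem rad_le_third {ε : ℝ} {ρ : ℕ} (hε : 0 ≤ ε) (hεE : ε * ρ ≤ 1 / 40) :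
    π / 2 * (((2 * (ρ - 1) : ℕ) : ℝ) * ε) ≤ (1 / 3 : ℝ) / 2 := by
  have hcast : ((2 * (ρ - 1) : ℕ) : ℝ) ≤ 2 * (ρ : ℝ) := by
    have h : 2 * (ρ - 1) ≤ 2 * ρ := by omega
    exact_mod_cast h
  have h1 : ((2 * (ρ - 1) : ℕ) : ℝ) * ε ≤ 1 / 20 :=
    calc ((2 * (ρ - 1) : ℕ) : ℝ) * ε ≤ 2 * (ρ : ℝ) * ε := mul_le_mul_of_nonneg_right hcast hε
      _ = 2 * (ε * ρ) := by ring
      _ ≤ 1 / 20 := by linarith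
  have hπ := Real.pi_pos
  calc π / 2 * (((2 * (ρ - 1) : ℕ) : ℝ) * ε) ≤ π / 2 * (1 / 20) := mul_le_mul_of_nonneg_left h1 (by positivity)
    _ ≤ (1 / 3 : ℝ) / 2 := by linarith [Real.pi_le_four]

/-- **The two-face packing count at `m := ρ`, `r := 1∕3`**: `3·n κ ≤ 4ρ + 3`, `ρ ≥ 2` give `n κ < 2ρ`, so `2·(n β∕ρ + 1)(n γ∕ρ + 1) ≤ 8` and
`8·(2∕(3π))·(1∕2)³ = 2∕(3π) < 1`. [folklore] -/
theorem card_lt_one_third {ρ nβ nγ : ℕ} (hρ : 2 ≤ ρ) (hβ : 3 * nβ ≤ 4 * ρ + 3) (hγ : 3 * nγ ≤ 4 * ρ + 3) :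
    ((2 * ((nβ / ρ + 1) * (nγ / ρ + 1)) : ℕ) : ℝ) * (2 / (3 * π) * (3 * (1 / 3 : ℝ) / 2) ^ 3) < 1 := by
  have hb : nβ / ρ < 2 := (Nat.div_lt_iff_lt_mul (by omega)).mpr (by omega)
  have hc : nγ / ρ < 2 := (Nat.div_lt_iff_lt_mul (by omega)).mpr (by omega)
  have hprod : (nβ / ρ + 1) * (nγ / ρ + 1) ≤ 2 * 2 := Nat.mul_le_mul (by omega) (by omega)
  have hcast : ((2 * ((nβ / ρ + 1) * (nγ / ρ + 1)) : ℕ) : ℝ) ≤ 8 := by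
    have h : 2 * ((nβ / ρ + 1) * (nγ / ρ + 1)) ≤ 8 := by omega
    exact_mod_cast h
  have hπ := Real.pi_gt_three
  have hx : (2 / (3 * π) * (3 * (1 / 3 : ℝ) / 2) ^ 3) = 1 / (12 * π) := by
    field_simp
    ring
  rw [hx]
  calc ((2 * ((nβ / ρ + 1) * (nγ / ρ + 1)) : ℕ) : ℝ) * (1 / (12 * π)) ≤ 8 * (1 / (12 * π)) :=
        mul_le_mul_of_nonneg_right hcast (by positivity)
    _ = 8 / (12 * π) := by ring
    _ < 1 := by rw [div_lt_one (by positivity)]; linarith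

/-- **The transverse bound at `r := 1∕3`**: `((π − 1∕3)∕sin (1∕3))·ε ≤ 16∕ρ` for `0 ≤ ε`, `ε·ρ ≤ 1∕40`, `1 ≤ ρ` (✓`Lambda_le`: `Λ ≤ π²∕(2r) ≤ 24`). [folklore] -/
theorem transverse_le_third {ε : ℝ} {ρ : ℕ} (hρ : 1 ≤ ρ) (hε : 0 ≤ ε) (hεE : ε * ρ ≤ 1 / 40) :
    (π - 1 / 3) / Real.sin (1 / 3) * ε ≤ 16 / ρ := by
  have hπ3 := Real.pi_gt_three
  have hΛ : (π - 1 / 3) / Real.sin (1 / 3) ≤ π ^ 2 / (2 * (1 / 3)) := Lambda_le (by norm_num) (by linarith)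
  have hΛ' : (π - 1 / 3) / Real.sin (1 / 3) ≤ 24 := by
    have h4 := Real.pi_le_four
    have hπ0 := Real.pi_pos
    calc (π - 1 / 3) / Real.sin (1 / 3) ≤ π ^ 2 / (2 * (1 / 3)) := hΛ
      _ ≤ 4 ^ 2 / (2 * (1 / 3)) := by gcongr
      _ = 24 := by norm_num
  have hρ0 : (0 : ℝ) < ρ := by exact_mod_cast hρ
  rw [le_div_iff₀ hρ0]
  calc (π - 1 / 3) / Real.sin (1 / 3) * ε * ρ = (π - 1 / 3) / Real.sin (1 / 3) * (ε * ρ) := by ring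
    _ ≤ 24 * (1 / 40) := mul_le_mul hΛ' hεE (by positivity) (by norm_num)
    _ ≤ 16 := by norm_num

/-- **The axial bound**: for `2 ≤ ρ ≤ n α`, `max (π∕(n α∕2)) (π∕(n α − n α∕2)) ≤ 16∕ρ` (`ρ ≤ 4·(n α∕2)`, `π ≤ 4`). [folklore] -/
theorem axial_le {ρ nα : ℕ} (hρ : 2 ≤ ρ) (hn : ρ ≤ nα) :
    max (π / ((nα / 2 : ℕ) : ℝ)) (π / ((nα - nα / 2 : ℕ) : ℝ)) ≤ 16 / ρ := by
  have h1 : ρ ≤ 4 * (nα / 2) := by omega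
  have h2 : ρ ≤ 4 * (nα - nα / 2) := by omega
  have hρ0 : (0 : ℝ) < ρ := by exact_mod_cast (show 0 < ρ by omega)
  have key : ∀ ℓ : ℕ, ρ ≤ 4 * ℓ → π / (ℓ : ℝ) ≤ 16 / ρ := by
    intro ℓ hℓ
    have hℓ0 : (0 : ℝ) < ℓ := by exact_mod_cast (show 0 < ℓ by omega)
    have hℓ' : (ρ : ℝ) ≤ 4 * ℓ := by exact_mod_cast hℓ
    rw [div_le_div_iff₀ hℓ0 hρ0]
    nlinarith [Real.pi_le_four, Real.pi_pos]
  exact max_le (key _ h1) (key _ h2)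

/-! ## §2 FILL₁ discharged -/

/-- ★★★ **FILL₁ — THE STAGE-1 FILLING LETTER OF `hSec_of_fillings`, DISCHARGED** (the binder `h₁` of ✓`…SectionsOfFillings.hSec_of_fillings`, byte for byte): with
`A := 16`, `ρ₀ := 2`, on every box of sides `n κ ∈ [ρ, (4ρ+3)∕3]`, `ρ ≥ 2`, `8ρ ≤ N`, every datum `ψ` admits `W` equal to `ψ` on the two `α`-faces of the box and,
whenever the face bonds of `ψ` are `ε`-slow with `ερ ≤ 1∕40`, `(16∕ρ)`-slow on every bond of the box (✓`twoFace_section` at `r := 1∕3`, `m := ρ`, `ℓ₁ := n α∕2`,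
`ℓ₂ := n α − n α∕2`; `W := ψ` off the slow premise). [cite: Balaban1985RegularSpaces, Thm 2 p.83] -/
theorem fill1 : ∃ A : ℝ, ∃ ρ₀ : ℕ, ∀ (P : Params), P.d = 3 → ∀ ρ : ℕ, ρ₀ ≤ ρ → 8 * ρ ≤ P.sitesPerDir 0 →
      ∀ (n s : Fin P.d → ℕ), (∀ κ, ρ ≤ n κ ∧ 3 * n κ ≤ 4 * ρ + 3) →
      ∀ (α : Fin P.d) (ψ : Site P 0 → SU2) (ε : ℝ), ∃ W : Site P 0 → SU2,
        (∀ x : Site P 0, (∀ κ, (x κ - ((s κ : ℕ) : ZMod (P.sitesPerDir 0))).val ≤ n κ) →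
          ((x α - ((s α : ℕ) : ZMod (P.sitesPerDir 0))).val = 0 ∨ (x α - ((s α : ℕ) : ZMod (P.sitesPerDir 0))).val = n α) → W x = ψ x) ∧
        ((0 ≤ ε ∧ ε * ρ ≤ 1 / 40 ∧ ∀ b : PBond P 0, (∀ κ, (b.src κ - ((s κ : ℕ) : ZMod (P.sitesPerDir 0))).val ≤ n κ) →
            (∀ κ, (b.tgt κ - ((s κ : ℕ) : ZMod (P.sitesPerDir 0))).val ≤ n κ) →
            ((b.src α - ((s α : ℕ) : ZMod (P.sitesPerDir 0))).val = 0 ∨ (b.src α - ((s α : ℕ) : ZMod (P.sitesPerDir 0))).val = n α) →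
            ((b.tgt α - ((s α : ℕ) : ZMod (P.sitesPerDir 0))).val = 0 ∨ (b.tgt α - ((s α : ℕ) : ZMod (P.sitesPerDir 0))).val = n α) →
            dist1 (ψ b.src * (ψ b.tgt)⁻¹) ≤ ε) →
          ∀ b : PBond P 0, (∀ κ, (b.src κ - ((s κ : ℕ) : ZMod (P.sitesPerDir 0))).val ≤ n κ) →
            (∀ κ, (b.tgt κ - ((s κ : ℕ) : ZMod (P.sitesPerDir 0))).val ≤ n κ) →
            dist1 (W b.src * (W b.tgt)⁻¹) ≤ A / ρ) := by
  refine ⟨16, 2, ?_⟩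
  intro P hd ρ hρ2 hρN n s hn α ψ ε
  by_cases hslow : (0 ≤ ε ∧ ε * ρ ≤ 1 / 40 ∧ ∀ b : PBond P 0, (∀ κ, (b.src κ - ((s κ : ℕ) : ZMod (P.sitesPerDir 0))).val ≤ n κ) →
            (∀ κ, (b.tgt κ - ((s κ : ℕ) : ZMod (P.sitesPerDir 0))).val ≤ n κ) →
            ((b.src α - ((s α : ℕ) : ZMod (P.sitesPerDir 0))).val = 0 ∨ (b.src α - ((s α : ℕ) : ZMod (P.sitesPerDir 0))).val = n α) →
            ((b.tgt α - ((s α : ℕ) : ZMod (P.sitesPerDir 0))).val = 0 ∨ (b.tgt α - ((s α : ℕ) : ZMod (P.sitesPerDir 0))).val = n α) →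
            dist1 (ψ b.src * (ψ b.tgt)⁻¹) ≤ ε)
  swap
  · exact ⟨ψ, fun _ _ _ => rfl, fun h => absurd h hslow⟩
  obtain ⟨hε, hεE, hlet⟩ := hslow
  have hρ1 : 1 ≤ ρ := by omega
  have hN : ∀ κ, n κ + 1 < P.sitesPerDir 0 := fun κ => side_lt (hn κ).2 hρN hρ1
  have hr : (0 : ℝ) < 1 / 3 := by norm_num
  have hrπ : 3 * (1 / 3 : ℝ) / 2 ≤ π := by linarith [Real.pi_gt_three]
  have hrad := rad_le_third (ρ := ρ) hε hεE
  have hcard : ∀ nβ nγ : ℕ, (∃ κ, nβ = n κ) → (∃ κ, nγ = n κ) →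
      ((2 * ((nβ / ρ + 1) * (nγ / ρ + 1)) : ℕ) : ℝ) * (2 / (3 * π) * (3 * (1 / 3 : ℝ) / 2) ^ 3) < 1 := by
    rintro nβ nγ ⟨κ₁, rfl⟩ ⟨κ₂, rfl⟩
    exact card_lt_one_third hρ2 (hn κ₁).2 (hn κ₂).2
  have hB1 := axial_le hρ2 (hn α).1
  have hB2 := transverse_le_third hρ1 hε hεE
  have hα := (hn α).1
  obtain ⟨W, hi, hb⟩ := twoFace_section hd n s hN α (n α / 2) (n α - n α / 2) (by omega) (by omega) (by omega)
    ψ hε hr hrπ ρ hρ1 hrad hcard hB1 hB2 hlet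
  exact ⟨W, hi, fun _ => hb⟩

/-! ## §3 `hBG` and the floored supplier letter, by kernel -/

/-- ★★★ **`hBG` HOLDS — THE N-UNIFORM SMALL-BOND GAUGE OF THE (BG∞) ROAD, BY KERNEL**: there are `C, c` with `0 ≤ C` such that every `SU(2)` lattice gauge field on
the unit three-torus lattice of a `T3Family` with `θ`-small plaquettes (`0 < θ`) is gauge-equivalent to one with EVERY bond `≤ C·√θ + c∕N_J` in the `logVec` chart —
✓`hBG_of_fillings` (LEAD-20520 w3 g29, p840681; inside: ✓`hBG_of_sections` p840037, ✓`hSec_of_fillings` p840533, ✓`fill_tube` px5, ✓`fill3` px8) at ★`fill1`.  An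
elementary torus-global consequence of the local small gauges; NOT a statement of Bałaban's papers and nothing of the renormalisation-group analysis.
[cite: Balaban1985RegularSpaces, Lemma 1 p.79, (1.29) p.81, Thm 2 p.83] -/
theorem hBG_holds :
    ∃ C c : ℝ, 0 ≤ C ∧ ∀ (F : T3Family) (J : ℕ) (θ : ℝ), 0 < θ → ∀ V : GaugeField (F.P J) 0 (Matrix.specialUnitaryGroup (Fin 2) ℂ), PlaqSmall θ V →
      ∃ u : GaugeTransf (F.P J) 0 (Matrix.specialUnitaryGroup (Fin 2) ℂ),
        ∀ e, ‖logVec (su2Quat (GaugeField.gaugeAct u V e))‖ ≤ C * Real.sqrt θ + c / (((F.P J).sitesPerDir 0 : ℕ) : ℝ) :=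
  hBG_of_fillings fill1

/-- ★★ **THE FLOORED SUPPLIER LETTER HOLDS** for every gauge-invariant class `G` and every `0 < s₀`: the conclusion of ✓`hsupp_floor_of_fillings` (= of
✓`hsupp_floor_of_sqrtGauge`, the `hsupp` binder of ✓`gapStratum_of_goodGauge_floor` at `G′ := G ∧ (∀ e, arc ≤ s₀)`) with NO filling hypothesis left.
[cite: Balaban1985UV3, (3) p.256; Balaban1985RegularSpaces, (1.29) p.81, Thm 2 p.83] -/
theorem hsupp_floor_holds
    (G : (F : T3Family) → (J : ℕ) → GaugeField (F.P J) 0 (Matrix.specialUnitaryGroup (Fin 2) ℂ) → Prop)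
    (hGinv : ∀ (F : T3Family) (J : ℕ) (u : GaugeTransf (F.P J) 0 (Matrix.specialUnitaryGroup (Fin 2) ℂ))
      (V : GaugeField (F.P J) 0 (Matrix.specialUnitaryGroup (Fin 2) ℂ)), G F J V → G F J (GaugeField.gaugeAct u V))
    {s₀ : ℝ} (hs₀ : 0 < s₀) :
    ∀ (L : ℕ), ∃ c₀ : ℝ, 0 < c₀ ∧ c₀ ≤ 1 ∧ ∀ (cw : ℝ), 0 < cw → cw ≤ c₀ → ∃ pS : ℝ, ∀ (b₀ p₀ : ℝ), 0 < b₀ → pS ≤ p₀ → 0 < p₀ →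
      ∃ γ₁ : ℝ, 0 < γ₁ ∧ ∀ (F : T3Family) (γ : ℝ), F.L = L → 0 < γ → γ ≤ γ₁ → ∃ J₀ : ℕ,
        ∀ (J : ℕ) (hJ₀ : J₀ ≤ J) (V : GaugeField (F.P J) 0 (Matrix.specialUnitaryGroup (Fin 2) ℂ)), PlaqSmall (θBal F.L γ (cw * b₀) p₀ J) V → G F J V →
          ∃ u : GaugeTransf (F.P J) 0 (Matrix.specialUnitaryGroup (Fin 2) ℂ),
            G F J (GaugeField.gaugeAct u V) ∧ ∀ e, ‖logVec (su2Quat (GaugeField.gaugeAct u V e))‖ ≤ s₀ :=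
  hsupp_floor_of_fillings G hGinv hs₀ fill1

end Summit.QuantumFields.YangMills.Theorems.FluctuationComparisonRegPrIntLS2BetaSqrtGaugeFill1

end
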